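import Summits.Ventures.LatticeQCDFlow.Scoring.U1TorusCharacterFormula
import Literature.Analysis.FunctionSpaces.BesselIRecurrence
import HarnessLib

/-!
# Two-sided bounds for the exact plaquette of the 2-d `U(1)` torus in terms of `I₁(β)/I₀(β)`

HONEST FRAMING: exact (Metropolis-corrected) sampling algorithms for lattice gauge theory;
figures of merit are autocorrelation/cost numbers at stated couplings and volumes; no
continuum-physics claim.

Venture `LatticeQCDFlow` (cell pub-lqcd), sub-topic `Scoring`; FANOUT row 5 (`s0-sun-a`), GEN-8.
NEW WORK of the cell (placement rule).  `Scoring/U1TorusCharacterFormula.lean` (GEN-7) proves the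
exact finite-torus plaquette `⟨cos θ_p⟩_{L₁×L₂,β} = N/Z`, `Z = Σ_{k∈ℤ} I_{|k|}(β)^V`,
`N = Σ_{k∈ℤ} I_{|k|}^{V−1}(I_{|k−1|}+I_{|k+1|})/2`, `V = L₁L₂` — the values the frozen scorers'
`reference_table v0.3` holds for `L = 16`; `Scoring/OnePlaquetteEnclosures.lean` (GEN-5) encloses
only the `V → ∞` limit `I₁/I₀`, and at `β = 6, 7` the `16²` torus value of record lies OUTSIDE that
enclosure (by `2.2·10⁻¹²`, `6.0·10⁻¹¹`).  This file reduces the torus value to the single ratio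
`t = I₁(β)/I₀(β)`, preparing kernel-checked enclosures of the torus values themselves
(`Scoring/U1TorusPlaquetteEnclosures.lean`):

* §1 `I_n ≤ I₀`, `1 ≤ I₀`, `0 < I_n` (`β > 0`), the two-step monotonicity `I_{n+2} ≤ I_n` (DLMF
  10.29.1), hence `I_k ≤ max(I₃, I₄)` for `k ≥ 3`, and `I₂, I₃, I₄` as polynomials in `I₀, I₁, 1/β`;
* §2 the torus sums split into the five central terms `|k| ≤ 2` and TAILS over `|k| ≥ 3`, bounded by
  `0 ≤ Σ_{|k|≥3} I_{|k|}^V ≤ m^{V−1} e^β`, `0 ≤ Σ_{|k|≥3} I_{|k|}^{V−1}(I_{|k−1|}+I_{|k+1|})/2 ≤ m^{V−2} I₀ e^β`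
  (`m = max(I₃, I₄)`, `Σ_{k∈ℤ} I_{|k|} = e^β`);
* `torusZ_central` / `torusN_central` — the central terms in closed form.

The companion `Scoring/U1TorusPlaquetteEnclosures.lean` turns these into a rational certificate
checker (`a ≤ I₁/I₀ ≤ b` from `Scoring/OnePlaquetteEnclosures.lean`, interval arithmetic through the
recurrences) and kernel-checked enclosures of the `16²` torus values.  Elementary; nothing is cited
beyond the DLMF tags already carried by the Bessel files.
-/

noncomputable section

open Real Finset
open scoped Nat
open Literature.Analysis.FunctionSpaces

namespace Summit.Ventures.LatticeQCDFlow.Scoring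

/-! ### 1. Elementary inequalities for `I_n` -/

/-- `I_n(x) ≤ I₀(x)` for every real `x` (`cos(nθ) ≤ 1` in DLMF 10.32.3). -/
theorem besselI_le_besselI_zero (n : ℕ) (x : ℝ) : besselI n x ≤ besselI 0 x := by
  unfold besselI
  refine mul_le_mul_of_nonneg_left ?_ (inv_pos.2 Real.pi_pos).le
  refine intervalIntegral.integral_mono_on Real.pi_pos.le ?_ ?_ fun θ _ => ?_
  · exact (by fun_prop : Continuous fun θ => Real.exp (x * Real.cos θ) * Real.cos (n * θ))
      |>.intervalIntegrable _ _
  · exact (by fun_prop : Continuous fun θ => Real.exp (x * Real.cos θ) * Real.cos ((0 : ℕ) * θ))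
      |>.intervalIntegrable _ _
  · rw [Nat.cast_zero, zero_mul, Real.cos_zero, mul_one]
    exact mul_le_of_le_one_right (Real.exp_pos _).le (Real.cos_le_one _)

/-- `1 ≤ I₀(x)` (the `k = 0` term of the power series DLMF 10.25.2). -/
theorem one_le_besselI_zero (x : ℝ) : 1 ≤ besselI 0 x := by
  have h := le_hasSum (hasSum_besselI 0 x) 0 fun j _ =>
    div_nonneg (by rw [add_zero, pow_mul]; positivity) (by positivity)
  simpa using h

/-- `0 < I_n(x)` for `x > 0` (all terms of the power series are positive). -/
theorem besselI_pos (n : ℕ) {x : ℝ} (hx : 0 < x) : 0 < besselI n x := by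
  rw [← (hasSum_besselI n x).tsum_eq]
  exact (hasSum_besselI n x).summable.tsum_pos (fun k => by positivity) 0 (by positivity)

/-- **Two-step monotonicity** `I_{n+2}(x) ≤ I_n(x)` for `x > 0` (from `x(I_n − I_{n+2}) = 2(n+1)I_{n+1} ≥ 0`). -/
theorem besselI_add_two_le (n : ℕ) {x : ℝ} (hx : 0 < x) : besselI (n + 2) x ≤ besselI n x := by
  have h := mul_besselI_sub_besselI_add_two n x
  have hpos : 0 ≤ x * (besselI n x - besselI (n + 2) x) := by
    rw [h]; have := (besselI_pos (n + 1) hx).le; positivity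
  have := nonneg_of_mul_nonneg_right (by rwa [mul_comm] at hpos) hx
  linarith

/-- For `k ≥ 3` and `x > 0`: `I_k(x) ≤ max (I₃(x)) (I₄(x))` (odd `k`: `≤ I₃`; even `k`: `≤ I₄`). -/
theorem besselI_le_max_three_four {x : ℝ} (hx : 0 < x) {k : ℕ} (hk : 3 ≤ k) :
    besselI k x ≤ max (besselI 3 x) (besselI 4 x) := by
  induction k using Nat.strong_induction_on with
  | _ k ih =>
    rcases Nat.lt_or_ge k 5 with h5 | h5
    · interval_cases k
      · exact le_max_left _ _
      · exact le_max_right _ _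
    · obtain ⟨j, rfl⟩ : ∃ j, k = j + 2 := ⟨k - 2, by omega⟩
      exact (besselI_add_two_le j hx).trans (ih j (by omega) (by omega))

/-- `I₂ = I₀ − 2I₁/x` (`x ≠ 0`). -/
theorem besselI_two_eq {x : ℝ} (hx : x ≠ 0) : besselI 2 x = besselI 0 x - 2 * besselI 1 x / x := by
  have h := mul_besselI_sub_besselI_add_two 0 x
  push_cast at h
  field_simp
  linarith

/-- `I₃ = I₁ − 4I₂/x` (`x ≠ 0`). -/
theorem besselI_three_eq {x : ℝ} (hx : x ≠ 0) : besselI 3 x = besselI 1 x - 4 * besselI 2 x / x := by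
  have h := mul_besselI_sub_besselI_add_two 1 x
  push_cast at h
  field_simp
  linarith

/-- `I₄ = I₂ − 6I₃/x` (`x ≠ 0`). -/
theorem besselI_four_eq {x : ℝ} (hx : x ≠ 0) : besselI 4 x = besselI 2 x - 6 * besselI 3 x / x := by
  have h := mul_besselI_sub_besselI_add_two 2 x
  push_cast at h
  field_simp
  linarith

/-! ### 2. The torus sums: central terms and tails -/

section Torus

variable {β : ℝ} (hβ : 0 < β) (V : ℕ)

/-- The five central charges. -/
def centralCharges : Finset ℤ := {-2, -1, 0, 1, 2}

/-- Off the five central charges, `|k| ≥ 3`. -/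
theorem three_le_natAbs_of_not_mem {k : ℤ} (hk : k ∉ centralCharges) : 3 ≤ k.natAbs := by
  simp only [centralCharges, Finset.mem_insert, Finset.mem_singleton, not_or] at hk
  omega

/-- The `Z`-summand `I_{|k|}^V` is summable over `ℤ` (`I_{|k|}^V ≤ I₀^{V−1} I_{|k|}`, `Σ I_{|k|} = e^β`). -/
theorem summable_besselI_natAbs_pow {β : ℝ} (hβ : 0 < β) {V : ℕ} (hV : 1 ≤ V) :
    Summable fun k : ℤ => besselI k.natAbs β ^ V := by
  obtain ⟨W, rfl⟩ := Nat.exists_eq_add_of_le' hV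
  refine Summable.of_nonneg_of_le (fun k => by have := (besselI_pos k.natAbs hβ).le; positivity)
    (fun k => ?_) ((summable_besselI_natAbs β).mul_left (besselI 0 β ^ W))
  rw [pow_succ]
  exact mul_le_mul_of_nonneg_right
    (pow_le_pow_left₀ (besselI_pos _ hβ).le (besselI_le_besselI_zero _ β) W) (besselI_pos _ hβ).le

/-- The `N`-summand is summable over `ℤ`. -/
theorem summable_torusN_term {β : ℝ} (hβ : 0 < β) {V : ℕ} (hV : 2 ≤ V) :
    Summable fun k : ℤ => besselI k.natAbs β ^ (V - 1) *
      ((besselI (k - 1).natAbs β + besselI (k + 1).natAbs β) / 2) := by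
  obtain ⟨W, rfl⟩ := Nat.exists_eq_add_of_le' hV
  have hI0 := (besselI_pos 0 hβ).le
  refine Summable.of_nonneg_of_le (fun k => ?_) (fun k => ?_)
    ((summable_besselI_natAbs β).mul_left (besselI 0 β ^ W * besselI 0 β))
  · have := (besselI_pos k.natAbs hβ).le
    have := (besselI_pos (k - 1).natAbs hβ).le
    have := (besselI_pos (k + 1).natAbs hβ).le
    positivity
  · rw [show W + 2 - 1 = W + 1 by omega, pow_succ]
    have h1 : besselI k.natAbs β ^ W ≤ besselI 0 β ^ W :=
      pow_le_pow_left₀ (besselI_pos _ hβ).le (besselI_le_besselI_zero _ β) W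
    have h2 : (besselI (k - 1).natAbs β + besselI (k + 1).natAbs β) / 2 ≤ besselI 0 β := by
      have := besselI_le_besselI_zero (k - 1).natAbs β
      have := besselI_le_besselI_zero (k + 1).natAbs β
      linarith
    have h3 := (besselI_pos k.natAbs hβ).le
    have h4 : 0 ≤ (besselI (k - 1).natAbs β + besselI (k + 1).natAbs β) / 2 := by
      have := (besselI_pos (k - 1).natAbs hβ).le
      have := (besselI_pos (k + 1).natAbs hβ).le
      positivity
    calc besselI k.natAbs β ^ W * besselI k.natAbs β *
          ((besselI (k - 1).natAbs β + besselI (k + 1).natAbs β) / 2)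
        ≤ besselI 0 β ^ W * besselI k.natAbs β * besselI 0 β :=
          mul_le_mul (mul_le_mul_of_nonneg_right h1 h3) h2 h4
            (mul_nonneg (pow_nonneg hI0 W) h3)
      _ = besselI 0 β ^ W * besselI 0 β * besselI k.natAbs β := by ring

/-- **Tail bound for `Z`**: `0 ≤ Σ_{|k| ≥ 3} I_{|k|}^V ≤ max(I₃,I₄)^{V−1} · e^β` (`V ≥ 1`). -/
theorem torusZ_tail_bounds {β : ℝ} (hβ : 0 < β) {V : ℕ} (hV : 1 ≤ V) :
    0 ≤ ∑' k : {k : ℤ // k ∉ centralCharges}, besselI k.1.natAbs β ^ V ∧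
    ∑' k : {k : ℤ // k ∉ centralCharges}, besselI k.1.natAbs β ^ V ≤
      max (besselI 3 β) (besselI 4 β) ^ (V - 1) * Real.exp β := by
  obtain ⟨W, rfl⟩ := Nat.exists_eq_add_of_le' hV
  set m := max (besselI 3 β) (besselI 4 β) with hm
  have hm0 : 0 ≤ m := (besselI_pos 3 hβ).le.trans (le_max_left _ _)
  have hS := summable_besselI_natAbs_pow hβ (V := W + 1) (by omega)
  refine ⟨tsum_nonneg fun k => by have := (besselI_pos k.1.natAbs hβ).le; positivity, ?_⟩
  rw [show W + 1 - 1 = W from rfl]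
  -- termwise: `I^{W+1} ≤ m^W · I`
  have hle : ∀ k : {k : ℤ // k ∉ centralCharges},
      besselI k.1.natAbs β ^ (W + 1) ≤ m ^ W * besselI k.1.natAbs β := fun k => by
    rw [pow_succ]
    exact mul_le_mul_of_nonneg_right (pow_le_pow_left₀ (besselI_pos _ hβ).le
      (besselI_le_max_three_four hβ (three_le_natAbs_of_not_mem k.2)) W) (besselI_pos _ hβ).le
  have hS1 : Summable fun k : {k : ℤ // k ∉ centralCharges} => m ^ W * besselI k.1.natAbs β :=
    ((summable_besselI_natAbs β).mul_left (m ^ W)).subtype _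
  calc ∑' k : {k : ℤ // k ∉ centralCharges}, besselI k.1.natAbs β ^ (W + 1)
      ≤ ∑' k : {k : ℤ // k ∉ centralCharges}, m ^ W * besselI k.1.natAbs β :=
        (hS.subtype _).tsum_le_tsum hle hS1
    _ = m ^ W * ∑' k : {k : ℤ // k ∉ centralCharges}, besselI k.1.natAbs β := tsum_mul_left
    _ ≤ m ^ W * ∑' k : ℤ, besselI k.natAbs β := by
        refine mul_le_mul_of_nonneg_left ?_ (pow_nonneg hm0 W)
        exact (summable_besselI_natAbs β).tsum_subtype_le (fun k : ℤ => besselI k.natAbs β)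
          {k : ℤ | k ∉ centralCharges} (fun k => (besselI_pos _ hβ).le)
    _ = m ^ W * Real.exp β := by rw [(hasSum_besselI_natAbs β).tsum_eq]

/-- **Tail bound for `N`**: `0 ≤ Σ_{|k|≥3} I_{|k|}^{V−1}(I_{|k−1|}+I_{|k+1|})/2 ≤ max(I₃,I₄)^{V−2} · I₀ · e^β`
(`V ≥ 2`). -/
theorem torusN_tail_bounds {β : ℝ} (hβ : 0 < β) {V : ℕ} (hV : 2 ≤ V) :
    0 ≤ ∑' k : {k : ℤ // k ∉ centralCharges}, besselI k.1.natAbs β ^ (V - 1) *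
        ((besselI (k.1 - 1).natAbs β + besselI (k.1 + 1).natAbs β) / 2) ∧
    ∑' k : {k : ℤ // k ∉ centralCharges}, besselI k.1.natAbs β ^ (V - 1) *
        ((besselI (k.1 - 1).natAbs β + besselI (k.1 + 1).natAbs β) / 2) ≤
      max (besselI 3 β) (besselI 4 β) ^ (V - 2) * besselI 0 β * Real.exp β := by
  obtain ⟨W, rfl⟩ := Nat.exists_eq_add_of_le' hV
  set m := max (besselI 3 β) (besselI 4 β) with hm
  have hm0 : 0 ≤ m := (besselI_pos 3 hβ).le.trans (le_max_left _ _)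
  have hS := summable_torusN_term hβ (V := W + 2) (by omega)
  have hnn : ∀ k : ℤ, 0 ≤ besselI k.natAbs β ^ (W + 2 - 1) *
      ((besselI (k - 1).natAbs β + besselI (k + 1).natAbs β) / 2) := fun k => by
    have := (besselI_pos k.natAbs hβ).le
    have := (besselI_pos (k - 1).natAbs hβ).le
    have := (besselI_pos (k + 1).natAbs hβ).le
    positivity
  refine ⟨tsum_nonneg fun k => hnn k.1, ?_⟩
  rw [show W + 2 - 2 = W from rfl]
  have hle : ∀ k : {k : ℤ // k ∉ centralCharges},
      besselI k.1.natAbs β ^ (W + 2 - 1) *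
        ((besselI (k.1 - 1).natAbs β + besselI (k.1 + 1).natAbs β) / 2) ≤
      m ^ W * besselI 0 β * besselI k.1.natAbs β := fun k => by
    rw [show W + 2 - 1 = W + 1 from rfl, pow_succ]
    have h1 : besselI k.1.natAbs β ^ W ≤ m ^ W :=
      pow_le_pow_left₀ (besselI_pos _ hβ).le
        (besselI_le_max_three_four hβ (three_le_natAbs_of_not_mem k.2)) W
    have h2 : (besselI (k.1 - 1).natAbs β + besselI (k.1 + 1).natAbs β) / 2 ≤ besselI 0 β := by
      have := besselI_le_besselI_zero (k.1 - 1).natAbs β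
      have := besselI_le_besselI_zero (k.1 + 1).natAbs β
      linarith
    have h3 := (besselI_pos k.1.natAbs hβ).le
    have h4 : 0 ≤ (besselI (k.1 - 1).natAbs β + besselI (k.1 + 1).natAbs β) / 2 := by
      have := (besselI_pos (k.1 - 1).natAbs hβ).le
      have := (besselI_pos (k.1 + 1).natAbs hβ).le
      positivity
    calc besselI k.1.natAbs β ^ W * besselI k.1.natAbs β *
          ((besselI (k.1 - 1).natAbs β + besselI (k.1 + 1).natAbs β) / 2)
        ≤ m ^ W * besselI k.1.natAbs β * besselI 0 β :=
          mul_le_mul (mul_le_mul_of_nonneg_right h1 h3) h2 h4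
            (mul_nonneg (pow_nonneg hm0 W) h3)
      _ = m ^ W * besselI 0 β * besselI k.1.natAbs β := by ring
  have hS1 : Summable fun k : {k : ℤ // k ∉ centralCharges} =>
      m ^ W * besselI 0 β * besselI k.1.natAbs β :=
    ((summable_besselI_natAbs β).mul_left (m ^ W * besselI 0 β)).subtype _
  calc ∑' k : {k : ℤ // k ∉ centralCharges}, besselI k.1.natAbs β ^ (W + 2 - 1) *
        ((besselI (k.1 - 1).natAbs β + besselI (k.1 + 1).natAbs β) / 2)
      ≤ ∑' k : {k : ℤ // k ∉ centralCharges}, m ^ W * besselI 0 β * besselI k.1.natAbs β :=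
        (hS.subtype _).tsum_le_tsum hle hS1
    _ = m ^ W * besselI 0 β * ∑' k : {k : ℤ // k ∉ centralCharges}, besselI k.1.natAbs β :=
        tsum_mul_left
    _ ≤ m ^ W * besselI 0 β * ∑' k : ℤ, besselI k.natAbs β := by
        refine mul_le_mul_of_nonneg_left ?_ (mul_nonneg (pow_nonneg hm0 W) (besselI_pos 0 hβ).le)
        exact (summable_besselI_natAbs β).tsum_subtype_le (fun k : ℤ => besselI k.natAbs β)
          {k : ℤ | k ∉ centralCharges} (fun k => (besselI_pos _ hβ).le)
    _ = m ^ W * besselI 0 β * Real.exp β := by rw [(hasSum_besselI_natAbs β).tsum_eq]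

/-- **The central terms of `Z`**: `Σ_{|k| ≤ 2} I_{|k|}^V = I₀^V + 2 I₁^V + 2 I₂^V`. -/
theorem torusZ_central (β : ℝ) (V : ℕ) :
    ∑ k ∈ centralCharges, besselI k.natAbs β ^ V =
      besselI 0 β ^ V + 2 * besselI 1 β ^ V + 2 * besselI 2 β ^ V := by
  simp only [centralCharges]
  norm_num
  ring

/-- **The central terms of `N`**:
`Σ_{|k| ≤ 2} I_{|k|}^{V−1}(I_{|k−1|}+I_{|k+1|})/2 = I₀^{V−1}I₁ + I₁^{V−1}(I₀+I₂) + I₂^{V−1}(I₁+I₃)`. -/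
theorem torusN_central (β : ℝ) (V : ℕ) :
    ∑ k ∈ centralCharges, besselI k.natAbs β ^ (V - 1) *
        ((besselI (k - 1).natAbs β + besselI (k + 1).natAbs β) / 2) =
      besselI 0 β ^ (V - 1) * besselI 1 β + besselI 1 β ^ (V - 1) * (besselI 0 β + besselI 2 β) +
        besselI 2 β ^ (V - 1) * (besselI 1 β + besselI 3 β) := by
  simp only [centralCharges]
  norm_num
  ring

end Torus

end Summit.Ventures.LatticeQCDFlow.Scoring
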